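import Mathlib
import Literature.NumberTheory.Transcendental.KZSemiCanonicalReductionProofs
import Summits.KontsevichZagierPeriods.KontsevichZagierPeriods.Theorems.SoloInformedVolumeCrux
import Summits.KontsevichZagierPeriods.KontsevichZagierPeriods.Theorems.SoloInformedKZUnitCube
import HarnessLib
import HarnessLib.Audit

/-!
# SoloInformed — the volume crux lives on semialgebraic subsets of the unit cube

`SoloInformedVolumeResolution` (every bounded `ℚ`-semialgebraic volume `[K, 1]` is presentable by
cube integrals of cube germs, inside the KZ calculus) follows from its special case for
INDICATOR FUNCTIONS OF SEMIALGEBRAIC SUBSETS OF THE UNIT CUBE: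
`SoloInformedCubeVolumeResolution := ∀ K ⊆ [0,1]^m` semialgebraic over `ℚ`, the representation
`[[0,1]^m, 1_K]` is presentable. Moves used: the affine change of variables
`y ↦ (y + R)/(2R)` (`R ∈ ℕ`, rule (2)), zero extension to the cube (rule (1), file
`SoloInformedKZUnitCube`), and `c • [D, f] ≡ [D, c f]` for `c ∈ ℕ` (rule (1b), induction).
Consequently
`soloInformed_ayoubTransfer₇ : SoloInformedSeparationOfPoles → SoloInformedCubeVolumeResolution →
SoloInformedAyoubKZeffQ → KontsevichZagierPeriods`.

References: Kontsevich–Zagier 2001, §1.2; Viu-Sos 2021, §2; Ayoub 2014, §2.2;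
Bochnak–Coste–Roy 1998, §2.2.
-/

noncomputable section

open scoped BigOperators
open MeasureTheory Set MvPolynomial
open Literature.NumberTheory.Transcendental Literature.NumberTheory.Transcendental.KZ
open Literature.ModelTheory.ExponentialFields (IsSemialgebraic)

namespace Summit.KontsevichZagierPeriods.KontsevichZagierPeriods.Theorems

variable {n : ℕ}

/-! ### Equal integrands, constant multiples -/

/-- Representations with the same domain and integrands agreeing on it differ by a relation.
[Kontsevich–Zagier 2001, §1.2 rule (1)] -/
theorem soloInformed_of_sub_of_mem_relations_of_eqOn (r r' : IntegralRep n)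
    (hd : r.domain = r'.domain) (h : EqOn r.integrand r'.integrand r.domain) :
    of r - of r' ∈ relations :=
  of_sub_of_mem_relations_of_null r r' (by rw [hd, Set.sdiff_self]; exact measure_empty)
    (by rw [hd, Set.sdiff_self]; exact measure_empty) (fun x hx => h hx.1)

/-- The representation `[D, c · f]` for `c ∈ ℚ`. -/
def soloInformedConstMulRep (ρ : IntegralRep n) (c : ℚ) : IntegralRep n where
  domain := ρ.domain
  integrand x := (c : ℝ) * ρ.integrand x
  isSemialgebraic_domain := ρ.isSemialgebraic_domain
  isSemialgebraicFunOn_integrand := by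
    by_cases hc : c = 0
    · subst hc
      exact (isSemialgebraicFunOn_aeval ρ.isSemialgebraic_domain
        (0 : MvPolynomial (Fin n) ℚ)).congr fun x _ => by simp
    · exact soloInformed_isSemialgebraicFunOn_const_mul ρ.isSemialgebraicFunOn_integrand hc
  integrableOn := ρ.integrableOn.const_mul _

/-- `c • [D, f] − [D, c f] ∈ KZ.relations` for `c ∈ ℕ` (rule (1b), induction on `c`).
[Kontsevich–Zagier 2001, §1.2 rule (1)] -/
theorem soloInformed_nsmul_of_sub_of_constMulRep (ρ : IntegralRep n) (c : ℕ) :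
    c • of ρ - of (soloInformedConstMulRep ρ c) ∈ relations := by
  induction c with
  | zero =>
    rw [zero_smul, zero_sub]
    exact relations.neg_mem (soloInformed_of_mem_relations_of_integrand_zero _ fun x _ => by
      simp [soloInformedConstMulRep])
  | succ c ih =>
    have h : of (soloInformedConstMulRep ρ ((c + 1 : ℕ) : ℚ)) - of (soloInformedConstMulRep ρ c) -
        of ρ ∈ relations :=
      integrandAddRel_subset_relations ⟨n, soloInformedConstMulRep ρ ((c + 1 : ℕ) : ℚ),
        soloInformedConstMulRep ρ (c : ℚ), ρ, rfl, rfl, fun x _ => by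
          simp only [soloInformedConstMulRep, Pi.add_apply]; push_cast; ring, rfl⟩
    have he : (c + 1) • of ρ - of (soloInformedConstMulRep ρ ((c + 1 : ℕ) : ℚ)) =
        (c • of ρ - of (soloInformedConstMulRep ρ c)) -
        (of (soloInformedConstMulRep ρ ((c + 1 : ℕ) : ℚ)) - of (soloInformedConstMulRep ρ c) -
          of ρ) := by
      rw [add_smul, one_smul]; abel
    rw [he]
    exact relations.sub_mem ih h

/-- Natural multiples of presentable elements are presentable. -/
theorem soloInformed_presentable_nsmul {x : FormalRep} (hx : x ∈ soloInformedPresentable)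
    (c : ℕ) : c • x ∈ soloInformedPresentable := by
  have he : c • x = ∑ _l : Fin c, x := by simp
  rw [he]
  exact soloInformed_presentable_sum _ _ fun _ _ => hx

/-! ### The affine normalisation `[-R, R]ⁿ → [0,1]ⁿ` -/

/-- `S_R y = (y + R)/(2R)`, coordinatewise. -/
def soloInformedShrinkMap (R : ℕ) (y : Fin n → ℝ) : Fin n → ℝ := fun i => (y i + R) / (2 * R)

/-- `E_R z = 2R z − R`, the inverse of `S_R`. -/
def soloInformedExpandMap (R : ℕ) (z : Fin n → ℝ) : Fin n → ℝ := fun i => 2 * R * z i - R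

/-- `S_R` as an affine map. -/
theorem soloInformedShrinkMap_eq (R : ℕ) :
    (soloInformedShrinkMap R : (Fin n → ℝ) → Fin n → ℝ) =
      fun y => ((2 * R : ℝ)⁻¹ • ContinuousLinearMap.id ℝ (Fin n → ℝ)) y +
        fun _ => (R : ℝ) / (2 * R) := by
  funext y i
  simp only [soloInformedShrinkMap, _root_.smul_apply, ContinuousLinearMap.id_apply,
    Pi.add_apply, Pi.smul_apply, smul_eq_mul]
  ring

/-- `E_R ∘ S_R = id` for `R ≠ 0`. -/
theorem soloInformedExpandMap_shrinkMap {R : ℕ} (hR : R ≠ 0) (y : Fin n → ℝ) :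
    soloInformedExpandMap R (soloInformedShrinkMap R y) = y := by
  funext i
  have hR' : (R : ℝ) ≠ 0 := by exact_mod_cast hR
  simp only [soloInformedShrinkMap, soloInformedExpandMap]
  field_simp
  ring

/-- `S_R` is injective for `R ≠ 0`. -/
theorem soloInformedShrinkMap_injective {R : ℕ} (hR : R ≠ 0) :
    Function.Injective (soloInformedShrinkMap R : (Fin n → ℝ) → Fin n → ℝ) :=
  Function.LeftInverse.injective (soloInformedExpandMap_shrinkMap hR)

/-- `S_R` has derivative `(2R)⁻¹ • id`. -/
theorem soloInformed_hasFDerivWithinAt_shrinkMap (R : ℕ) (s : Set (Fin n → ℝ)) (x : Fin n → ℝ) :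
    HasFDerivWithinAt (soloInformedShrinkMap R)
      ((2 * R : ℝ)⁻¹ • ContinuousLinearMap.id ℝ (Fin n → ℝ)) s x := by
  rw [soloInformedShrinkMap_eq]
  exact (((ContinuousLinearMap.id ℝ (Fin n → ℝ)).hasFDerivWithinAt).const_smul
    ((2 * R : ℝ)⁻¹)).add_const _

/-- `|det ((2R)⁻¹ • id)| = (2R)⁻ⁿ`. -/
theorem soloInformed_abs_det_shrink (R n : ℕ) :
    |(((2 * R : ℝ)⁻¹) • ContinuousLinearMap.id ℝ (Fin n → ℝ)).det| = ((2 * R : ℝ)⁻¹) ^ n := by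
  rw [ContinuousLinearMap.det, ContinuousLinearMap.toLinearMap_smul, ContinuousLinearMap.coe_id,
    LinearMap.det_smul, LinearMap.det_id, mul_one, Module.finrank_fintype_fun_eq_card,
    Fintype.card_fin]
  exact abs_of_nonneg (by positivity)

/-- `S_R` is a polynomial map over `ℚ`. [BCR 1998, §2.2] -/
theorem soloInformed_isSemialgebraicMapOn_shrinkMap (R : ℕ) {s : Set (Fin n → ℝ)}
    (hs : IsSemialgebraic ℚ s) : IsSemialgebraicMapOn ℚ s (soloInformedShrinkMap R) := by
  refine (isSemialgebraicMapOn_aeval (R := ℝ) hs fun l : Fin n =>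
    MvPolynomial.C ((1 : ℚ) / (2 * R)) * (MvPolynomial.X l + MvPolynomial.C (R : ℚ))).congr
      fun x _ => ?_
  ext l
  simp only [soloInformedShrinkMap, map_add, map_mul, MvPolynomial.aeval_C, MvPolynomial.aeval_X,
    eq_ratCast]
  push_cast
  ring

/-- `E_R` is a polynomial map over `ℚ`. [BCR 1998, §2.2] -/
theorem soloInformed_isSemialgebraicMapOn_expandMap (R : ℕ) {s : Set (Fin n → ℝ)}
    (hs : IsSemialgebraic ℚ s) : IsSemialgebraicMapOn ℚ s (soloInformedExpandMap R) := by
  refine (isSemialgebraicMapOn_aeval (R := ℝ) hs fun l : Fin n =>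
    MvPolynomial.C ((2 : ℚ) * R) * MvPolynomial.X l - MvPolynomial.C (R : ℚ)).congr fun x _ => ?_
  ext l
  simp only [soloInformedExpandMap, map_sub, map_mul, MvPolynomial.aeval_C, MvPolynomial.aeval_X,
    eq_ratCast]
  push_cast
  ring

/-- `S_R` maps `[-R, R]ⁿ` into `[0,1]ⁿ` (`R ≠ 0`). -/
theorem soloInformed_shrinkMap_mem_cube {R : ℕ} (hR : R ≠ 0) {y : Fin n → ℝ}
    (hy : ∀ i, -(R : ℝ) ≤ y i ∧ y i ≤ R) : soloInformedShrinkMap R y ∈ soloInformedCube n := by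
  rw [soloInformed_mem_cube_iff]
  intro i
  obtain ⟨h1, h2⟩ := hy i
  have hR' : (0 : ℝ) < R := by exact_mod_cast Nat.pos_of_ne_zero hR
  simp only [soloInformedShrinkMap]
  constructor
  · exact div_nonneg (by linarith) (by linarith)
  · rw [div_le_one (by linarith)]
    linarith

/-- **The shrunk representation** `(S_R)_* s`: domain `S_R '' s.domain`, integrand
`z ↦ s.integrand (E_R z) · (2R)ⁿ`. [BCR 1998, Prop. 2.2.6–2.2.7] -/
def soloInformedShrinkRep (R : ℕ) (hR : R ≠ 0) (s : IntegralRep n) : IntegralRep n where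
  domain := soloInformedShrinkMap R '' s.domain
  integrand z := s.integrand (soloInformedExpandMap R z) * (2 * R) ^ n
  isSemialgebraic_domain :=
    IsSemialgebraicMapOn.isSemialgebraic_image_holds
      (soloInformed_isSemialgebraicMapOn_shrinkMap R s.isSemialgebraic_domain) Subset.rfl
      s.isSemialgebraic_domain
  isSemialgebraicFunOn_integrand := by
    have hS : IsSemialgebraic ℚ (soloInformedShrinkMap R '' s.domain) :=
      IsSemialgebraicMapOn.isSemialgebraic_image_holds
        (soloInformed_isSemialgebraicMapOn_shrinkMap R s.isSemialgebraic_domain) Subset.rfl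
        s.isSemialgebraic_domain
    have hmaps : MapsTo (soloInformedExpandMap R) (soloInformedShrinkMap R '' s.domain)
        s.domain := by
      rintro _ ⟨x, hx, rfl⟩
      rw [soloInformedExpandMap_shrinkMap hR]
      exact hx
    have hcomp := IsSemialgebraicFunOn.comp_isSemialgebraicMapOn_holds
      s.isSemialgebraicFunOn_integrand (soloInformed_isSemialgebraicMapOn_expandMap R hS) hmaps
    have hc : IsSemialgebraicFunOn ℚ (soloInformedShrinkMap R '' s.domain)
        (fun _ => (2 * R : ℝ) ^ n) :=
      (isSemialgebraicFunOn_aeval hS (MvPolynomial.C (((2 : ℚ) * R) ^ n))).congr fun x _ => by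
        simp
    exact IsSemialgebraicFunOn.mul_holds hcomp hc
  integrableOn := by
    have hDm : MeasurableSet s.domain :=
      IsSemialgebraic.measurableSet_holds s.isSemialgebraic_domain
    have hR' : (2 * R : ℝ) ≠ 0 := by exact_mod_cast mul_ne_zero two_ne_zero hR
    rw [integrableOn_image_iff_integrableOn_abs_det_fderiv_smul volume hDm
      (fun x _ => soloInformed_hasFDerivWithinAt_shrinkMap R s.domain x)
      (soloInformedShrinkMap_injective hR).injOn]
    refine s.integrableOn.congr_fun (fun x _ => ?_) hDm
    rw [soloInformed_abs_det_shrink, soloInformedExpandMap_shrinkMap hR, smul_eq_mul]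
    have h2 : ((2 * R : ℝ)⁻¹) ^ n * (2 * R) ^ n = 1 := by
      rw [← mul_pow, inv_mul_cancel₀ hR', one_pow]
    calc s.integrand x = s.integrand x * (((2 * R : ℝ)⁻¹) ^ n * (2 * R) ^ n) := by
          rw [h2, mul_one]
      _ = ((2 * R : ℝ)⁻¹) ^ n * (s.integrand x * (2 * R) ^ n) := by ring

/-- **Shrinking is a KZ move**: `[s] − [(S_R)_* s] ∈ KZ.relations`.
[Kontsevich–Zagier 2001, §1.2 rule (2)] -/
theorem soloInformed_shrinkRep_mem_relations {R : ℕ} (hR : R ≠ 0) (s : IntegralRep n) :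
    of s - of (soloInformedShrinkRep R hR s) ∈ relations := by
  have hR' : (2 * R : ℝ) ≠ 0 := by exact_mod_cast mul_ne_zero two_ne_zero hR
  refine changeOfVariablesRel_subset_relations ⟨n, s, soloInformedShrinkRep R hR s,
    soloInformedShrinkMap R, fun _ => (2 * R : ℝ)⁻¹ • ContinuousLinearMap.id ℝ (Fin n → ℝ),
    soloInformed_isSemialgebraicMapOn_shrinkMap R s.isSemialgebraic_domain,
    fun x _ => soloInformed_hasFDerivWithinAt_shrinkMap R s.domain x,
    (soloInformedShrinkMap_injective hR).injOn, rfl, fun x _ => ?_, rfl⟩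
  show s.integrand x = s.integrand (soloInformedExpandMap R (soloInformedShrinkMap R x)) *
    (2 * R) ^ n * |((2 * R : ℝ)⁻¹ • ContinuousLinearMap.id ℝ (Fin n → ℝ)).det|
  rw [soloInformedExpandMap_shrinkMap hR, soloInformed_abs_det_shrink, mul_assoc, ← mul_pow,
    mul_inv_cancel₀ hR', one_pow, mul_one]

/-- A bounded set lies in some box `[-R, R]ⁿ` with `R ∈ ℕ`, `R ≠ 0`. -/
theorem soloInformed_exists_box_of_isBounded {D : Set (Fin n → ℝ)} (hD : Bornology.IsBounded D) :
    ∃ R : ℕ, R ≠ 0 ∧ D ⊆ {y | ∀ i, -(R : ℝ) ≤ y i ∧ y i ≤ R} := by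
  obtain ⟨C, hC⟩ := hD.exists_norm_le
  refine ⟨⌈C⌉₊ + 1, Nat.succ_ne_zero _, fun y hy i => ?_⟩
  have h1 : |y i| ≤ C := (norm_le_pi_norm y i).trans (hC y hy)
  have h2 : (C : ℝ) ≤ (⌈C⌉₊ : ℝ) + 1 := (Nat.le_ceil C).trans (le_add_of_nonneg_right zero_le_one)
  rw [abs_le] at h1
  push_cast
  constructor <;> linarith [h1.1, h1.2]

/-! ### Indicator representations and the cube volume crux -/

/-- The unit cube has finite volume. -/
theorem soloInformed_volume_cube_lt_top (m : ℕ) : volume (soloInformedCube m) < ⊤ := by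
  have h : soloInformedCube m = Icc (0 : Fin m → ℝ) 1 := by
    ext z
    simp only [soloInformed_mem_cube_iff, mem_Icc, Pi.le_def, Pi.zero_apply, Pi.one_apply]
    exact ⟨fun h => ⟨fun i => (h i).1, fun i => (h i).2⟩, fun h i => ⟨h.1 i, h.2 i⟩⟩
  rw [h]
  exact isCompact_Icc.measure_lt_top

/-- **The indicator representation** `[[0,1]^m, 1_K]` of a `ℚ`-semialgebraic `K ⊆ [0,1]^m`. -/
def soloInformedIndicatorRep {m : ℕ} (K : Set (Fin m → ℝ)) (hK : IsSemialgebraic ℚ K)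
    (hKc : K ⊆ soloInformedCube m) : IntegralRep m where
  domain := soloInformedCube m
  integrand := K.indicator fun _ => 1
  isSemialgebraic_domain := isSemialgebraic_soloInformedCube m
  isSemialgebraicFunOn_integrand :=
    soloInformed_isSemialgebraicFunOn_indicator (isSemialgebraic_soloInformedCube m) hK hKc
      ((isSemialgebraicFunOn_aeval hK (1 : MvPolynomial (Fin m) ℚ)).congr fun x _ => by simp)
  integrableOn :=
    (integrableOn_const (soloInformed_volume_cube_lt_top m).ne).indicator
      (IsSemialgebraic.measurableSet_holds hK)

/-- **The cube volume crux.** For every `ℚ`-semialgebraic `K ⊆ [0,1]^m`, the indicator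
representation `[[0,1]^m, 1_K]` is KZ-equivalent, up to a positive multiple, to an integer
combination of cube integrals of real parts of cube germs (resolution of the singularities of `∂K`
inside the KZ calculus). [Ayoub 2014, §2.2; Kontsevich–Zagier 2001, §1.2] -/
@[conjecture] def SoloInformedCubeVolumeResolution : Prop :=
  ∀ (m : ℕ) (K : Set (Fin m → ℝ)) (hK : IsSemialgebraic ℚ K) (hKc : K ⊆ soloInformedCube m),
    of (soloInformedIndicatorRep K hK hKc) ∈ soloInformedPresentable

/-- **Bounded volumes reduce to indicator representations on the cube.**
[Kontsevich–Zagier 2001, §1.2 rules (1), (2)] -/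
theorem soloInformed_volumeResolution_of_cube (h : SoloInformedCubeVolumeResolution) :
    SoloInformedVolumeResolution := by
  intro m V hb h1
  obtain ⟨R, hR, hbox⟩ := soloInformed_exists_box_of_isBounded hb
  -- shrink into the cube
  set s := soloInformedShrinkRep R hR V with hs
  have hsub : s.domain ⊆ soloInformedCube m := by
    rintro _ ⟨y, hy, rfl⟩
    exact soloInformed_shrinkMap_mem_cube hR (hbox hy)
  -- zero extension to the cube
  set e := soloInformedExtendRep s (soloInformedCube m) (isSemialgebraic_soloInformedCube m) hsub
    with he
  -- the indicator representation and its constant multiple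
  set ρ := soloInformedIndicatorRep s.domain s.isSemialgebraic_domain hsub with hρ
  have heq : of e - of (soloInformedConstMulRep ρ (((2 * R) ^ m : ℕ) : ℚ)) ∈ relations := by
    refine soloInformed_of_sub_of_mem_relations_of_eqOn _ _ rfl fun z _ => ?_
    show s.domain.indicator s.integrand z = _ * s.domain.indicator (fun _ => (1 : ℝ)) z
    by_cases hz : z ∈ s.domain
    · rw [indicator_of_mem hz, indicator_of_mem hz, mul_one]
      obtain ⟨y, hy, rfl⟩ := hz
      show V.integrand (soloInformedExpandMap R (soloInformedShrinkMap R y)) * (2 * R) ^ m = _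
      rw [soloInformedExpandMap_shrinkMap hR, h1 y hy, one_mul]
      push_cast
      ring
    · rw [indicator_of_notMem hz, indicator_of_notMem hz, mul_zero]
  have h2 : of s - of e ∈ relations := by
    have := relations.neg_mem (soloInformed_extendRep_mem_relations s (soloInformedCube m)
      (isSemialgebraic_soloInformedCube m) hsub)
    rwa [neg_sub] at this
  have h3 : of (soloInformedConstMulRep ρ (((2 * R) ^ m : ℕ) : ℚ)) - ((2 * R) ^ m) • of ρ ∈
      relations := by
    have := relations.neg_mem (soloInformed_nsmul_of_sub_of_constMulRep ρ ((2 * R) ^ m))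
    rwa [neg_sub] at this
  have hP : of V ∈ soloInformedPresentable :=
    soloInformed_presentable_of_sub_mem (soloInformed_shrinkRep_mem_relations hR V)
      (soloInformed_presentable_of_sub_mem h2
        (soloInformed_presentable_of_sub_mem heq
          (soloInformed_presentable_of_sub_mem h3
            (soloInformed_presentable_nsmul (h m s.domain s.isSemialgebraic_domain hsub) _))))
  exact soloInformed_exists_fin_of_presentable hP

/-- The cube volume crux is a special case of the volume crux. -/
theorem soloInformed_cubeVolumeResolution_of_volume (h : SoloInformedVolumeResolution) :
    SoloInformedCubeVolumeResolution := by
  intro m K hK hKc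
  -- `[cube, 1_K] ≡ [K, 1]` by zero extension of the restriction
  set r : IntegralRep m := (soloInformedIndicatorRep K hK hKc).restrict K hK hKc with hr
  have h1 : of (soloInformedIndicatorRep K hK hKc) -
      of (soloInformedExtendRep r (soloInformedCube m) (isSemialgebraic_soloInformedCube m) hKc) ∈
        relations :=
    soloInformed_of_sub_of_mem_relations_of_eqOn _ _ rfl fun z _ => by
      show K.indicator (fun _ => (1 : ℝ)) z = K.indicator (K.indicator fun _ => (1 : ℝ)) z
      rw [indicator_indicator, inter_self]
  have hb : Bornology.IsBounded r.domain := by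
    refine (isCompact_Icc (a := (0 : Fin m → ℝ)) (b := 1)).isBounded.subset fun z hz => ?_
    have hz' := soloInformed_mem_cube_iff.1 (hKc hz)
    exact ⟨fun i => (hz' i).1, fun i => (hz' i).2⟩
  obtain ⟨k, hk, M, d, G, c, ρ, hd, hI, hrel⟩ :=
    h m r hb fun x hx => by
      show K.indicator (fun _ => (1 : ℝ)) x = 1
      exact indicator_of_mem (show x ∈ K from hx) _
  exact soloInformed_presentable_of_sub_mem h1
    (soloInformed_presentable_of_sub_mem (soloInformed_extendRep_mem_relations r _ _ hKc)
      (soloInformed_mem_presentable_iff.2 ⟨k, hk, Fin M, inferInstance, d, G, c, ρ, hd, hI, hrel⟩))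

/-- `SoloInformedCubeVolumeResolution ↔ SoloInformedVolumeResolution`. -/
theorem soloInformed_cubeVolumeResolution_iff :
    SoloInformedCubeVolumeResolution ↔ SoloInformedVolumeResolution :=
  ⟨soloInformed_volumeResolution_of_cube, soloInformed_cubeVolumeResolution_of_volume⟩

/-- **The Ayoub transfer from cube volumes**: separation of poles in dimension `≥ 2`
[Viu-Sos 2021, Cor. 2.2], the cube volume crux and Ayoub's conjecture up to torsion
[Ayoub 2014, Conj. 7, Prop. 11] imply the Kontsevich–Zagier period conjecture. -/
theorem soloInformed_ayoubTransfer₇ (H₂ : SoloInformedSeparationOfPoles)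
    (hV : SoloInformedCubeVolumeResolution) (hA : SoloInformedAyoubKZeffQ) :
    KontsevichZagierPeriods :=
  soloInformed_ayoubTransfer₆ H₂ (soloInformed_volumeResolution_of_cube hV) hA

end Summit.KontsevichZagierPeriods.KontsevichZagierPeriods.Theorems
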